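import Mathlib
import Literature.NumberTheory.LFunctions.Zhang2022.Section12Htilde15AFE
import Literature.NumberTheory.LFunctions.Zhang2022.Section11AFEWide
import Literature.NumberTheory.LFunctions.Zhang2022.Section12Eq128Reduction
import HarnessLib

/-!
# Zhang (2022) §12 (12.8): `Typed.Sec12A.Eq128` reduced to the dual-window `S_j`-estimate ALONE

Topic `Literature/NumberTheory/LFunctions/Zhang2022` (Landau–Siegel audit tree; verdict-neutral).
Y. Zhang, *Discrete mean estimates and the Landau–Siegel zero*, arXiv:2211.02515v1 (2022)
[Zhang2022LandauSiegel] — **an unrefereed manuscript under adjudication; nothing here asserts or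
denies its Theorems 1–2.** ZHANG-L lane, WP12, leaf hXi / binder h128 (RT-06), row G-d42-3.

One composition, kernel-checked: `Typed.Sec12A.eq128_of_sjDual_small` — **(12.8) `Typed.Sec12A.Eq128 c'`
from the single unprinted estimate hS′** (the dual-window `S_j`-smallness "`‖S_j(c̄,c)‖ ≤ εα𝔞`" of
`eq128_of_sj_small`, stated there verbatim; row G-d42-3 (ii)) and the in-scope §2/§7/§8 inputs
Prop. 2.2 (i), Lemma 2.3, Lemma 8.1, Prop. 7.1: the tree's `eq128_of_sj_small`
(`Section12Eq128Reduction`: the deduction `Ded128R` with Lemma 5.1 (5.4), `DualTailsSmall`, `IntGDual`,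
`E2ShiftMeanSq` discharged inside) with its approximate-functional-equation hypothesis PLUGGED by
node `Z22:§12.u009` in the `ε`-carrying reading on the full typed range, i.e. by the term
`htilde15ApproxFEe_of_afeWide Section11AFE.step11u024e_wide` (`Section12Htilde15AFE` ∘
`Section11AFEWide`; the same term is recorded as `Typed.Sec12A.htilde15ApproxFEe_holds` in
`Section12Htilde15AFEFull`). So the binder h128 of the skeleton rests on hS′ alone.

Theorem-only; 0 definitions, 0 claims, 0 facts; standard axioms.

## References

* Y. Zhang, arXiv:2211.02515v1 (2022), §12 p. 67, (12.8); §11 Lemma 11.2.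
  [cite: Zhang2022LandauSiegel, §12 (12.8) p. 67]
-/

noncomputable section

open Complex Real ComplexConjugate

namespace Literature.NumberTheory.LFunctions.Zhang2022.Typed.Sec12A

open Skeleton

/-- **(12.8) from the dual-window `S_j`-estimate alone**: `Typed.Sec12A.Eq128 c'` follows from
Prop. 2.2 (i), Lemma 2.3, Lemma 8.1, Prop. 7.1 (in scope in the skeleton) and the ONE unprinted
estimate hS′ of `eq128_of_sj_small` ("`‖S_j(c̄,c)‖ ≤ εα𝔞` for the dual-window coefficient difference",
row G-d42-3 (ii)), the `H̃₁₅` approximate functional equation being supplied by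
`htilde15ApproxFEe_of_afeWide Section11AFE.step11u024e_wide` (= `htilde15ApproxFEe_holds`).
[cite: Zhang2022LandauSiegel, §12 (12.8) p. 67] -/
theorem eq128_of_sjDual_small (c' : ℝ) (h22 : Prop22i) (h23 : Lemma23 c') (h81 : Lemma81 c')
    (h71 : Prop71 c')
    (hS : ∀ ε : ℝ, 0 < ε → ForAllLarge fun D _ χ => AssumptionA D χ →
      ∀ j ∈ ({1, 2, 3} : Finset ℕ),
        ‖Sj c' D j
            (fun n : ℕ => conj ((if n ∈ ((Finset.Ico 1 ⌈P2pp D * etaPM D 1⌉₊).filter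
          (fun n : ℕ => P1pp D * etaPM D (-1) < n ∧ (n : ℝ) < P2pp D * etaPM D 1)) then
          χ (n : ZMod D) * (((n : ℝ) / P1pp D : ℝ) : ℂ) ^ beta6 D * ((dualInt D n / 0.504 : ℝ) : ℂ)
        else 0) -
        (if n ∈ ((Finset.Ico 1 ⌈P2pp D⌉₊).filter (fun n : ℕ => P1pp D < n ∧ (n : ℝ) < P2pp D)) then
          χ (n : ZMod D) * (((n : ℝ) / P1pp D : ℝ) : ℂ) ^ beta6 D *
            ((Real.log ((n : ℝ) / P1pp D) / Real.log (Skeleton.P1 D) : ℝ) : ℂ)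
        else 0)))
            (fun n : ℕ => (if n ∈ ((Finset.Ico 1 ⌈P2pp D * etaPM D 1⌉₊).filter
          (fun n : ℕ => P1pp D * etaPM D (-1) < n ∧ (n : ℝ) < P2pp D * etaPM D 1)) then
          χ (n : ZMod D) * (((n : ℝ) / P1pp D : ℝ) : ℂ) ^ beta6 D * ((dualInt D n / 0.504 : ℝ) : ℂ)
        else 0) -
        (if n ∈ ((Finset.Ico 1 ⌈P2pp D⌉₊).filter (fun n : ℕ => P1pp D < n ∧ (n : ℝ) < P2pp D)) then
          χ (n : ZMod D) * (((n : ℝ) / P1pp D : ℝ) : ℂ) ^ beta6 D *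
            ((Real.log ((n : ℝ) / P1pp D) / Real.log (Skeleton.P1 D) : ℝ) : ℂ)
        else 0))‖ ≤
          ε * alpha D * frakA χ) :
    Eq128 c' :=
  eq128_of_sj_small c' h22 h23 h81 h71
    (htilde15ApproxFEe_of_afeWide Section11AFE.step11u024e_wide) hS

end Literature.NumberTheory.LFunctions.Zhang2022.Typed.Sec12A
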